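import Mathlib.LinearAlgebra.FiniteDimensional.Lemmas
import Mathlib.LinearAlgebra.Dimension.Finrank
import Mathlib.Algebra.BigOperators.Group.Finset.Basic
import HarnessLib

/-!
# The reduced basis of a subspace with respect to an ordered coordinate system is canonical
(w1-cx-2 gen 14; kernel leg of the «×2 ∕ ×3 ACROSS KERNELS» results of the W1 census chapter)

Cell pub-hsemireg, W1 «objects beyond sheaves», model level.  Code B's gauge («gauge B») is built from
chart bases that are REDUCED ECHELON bases of kernels (of the substitution maps `res_{z,ε}`,
`res_{z,ε} ∘ ∂₂`) with respect to a fixed total order on bimonomials, and from a greedy SDR driven by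
the same order.  Two independent re-implementations (w1-aut-2 g15's code C; this seat's clean-room
kernel, HOME/INBOX RESULT #9 of the w1-cx-2 lineage) land on the SAME harmonic representatives and the
SAME exact word values.  The linear-algebra fact underneath is recorded here, PLAIN (no definitions:
«lead», «pivot», «reduced» are spelled out as hypotheses).  For a subspace `U` of `ι → K`, `ι` a finite
linear order, say `m` is the LEAD of `v` if `v m ≠ 0` and `v m' = 0` for all `m' > m`, and call `m` a
PIVOT of `U` if it is the lead of some vector of `U`; `P : Finset ι` below is the pivot set
(hypothesis `hP`).  A vector `u` is REDUCED at the pivot `m` if `u ∈ U`, `u m = 1` and `u` vanishes at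
every other pivot.  Then:

* a vector of `U` vanishing at every pivot is zero (`eq_zero_of_forall_pivot`);
* the reduced vector at `m` is UNIQUE (`reduced_unique`) and its lead is `m` (`lead_of_reduced`);
* it EXISTS for every pivot (`exists_reduced`: the pivot-coordinate map `U → (P → K)` is injective and
  `U` contains `|P|` independent lead vectors, so the map is onto);
* a reduced family is linearly independent and every `v ∈ U` equals `∑_{m ∈ P} v m • u_m`
  (`linearIndependent_reduced`, `eq_sum_smul_reduced`).

So the reduced basis is determined by `(U, ≤)` alone: any two programs computing «the RREF kernel basis
with pivot = highest monomial» must agree vector for vector — which is what the cross-kernel agreement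
observes.  Elementary (reduced row echelon form); recorded because results of record rest on it.
Nothing here says HC, HC_CM or HC_AV is proved.
-/

namespace Summit.Ventures.HSemireg.CanonicalReducedBasis

open BigOperators

variable {K : Type*} [Field K] {ι : Type*} [LinearOrder ι]

/-- Leads are unique: if `v` is non-zero at `m` and vanishes above `m`, and the same holds at `m'`,
then `m = m'`. -/
theorem lead_unique {v : ι → K} {m m' : ι} (hm : v m ≠ 0) (hma : ∀ k, m < k → v k = 0)
    (hm' : v m' ≠ 0) (hm'a : ∀ k, m' < k → v k = 0) : m = m' := by
  rcases lt_trichotomy m m' with hlt | heq | hgt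
  · exact absurd (hma m' hlt) hm'
  · exact heq
  · exact absurd (hm'a m hgt) hm

/-- Vectors with prescribed pairwise distinct leads (for each `m ∈ P`, `w m` is non-zero at `m` and
vanishes above `m`) are linearly independent: evaluate a vanishing combination at the largest index
carrying a non-zero coefficient. -/
theorem linearIndependent_of_lead (P : Finset ι) (w : ι → ι → K)
    (hw : ∀ m ∈ P, w m m ≠ 0) (hwa : ∀ m ∈ P, ∀ k, m < k → w m k = 0) :
    LinearIndependent K (fun m : P => w m) := by
  classical
  rw [Fintype.linearIndependent_iff]
  intro g hg
  by_contra hcon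
  push Not at hcon
  obtain ⟨i₀, hi₀⟩ := hcon
  have hS : (Finset.univ.filter fun i : P => g i ≠ 0).Nonempty := ⟨i₀, by simp [hi₀]⟩
  set i := (Finset.univ.filter fun i : P => g i ≠ 0).max' hS with hi
  have himem : g i ≠ 0 := by
    have := Finset.max'_mem _ hS; rw [Finset.mem_filter] at this; exact this.2
  have hcoord := congr_fun hg (i : ι)
  simp only [Finset.sum_apply, Pi.smul_apply, smul_eq_mul, Pi.zero_apply] at hcoord
  rw [Finset.sum_eq_single i] at hcoord
  · exact (mul_ne_zero himem (hw i i.2)) hcoord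
  · intro j _ hji
    by_cases hgj : g j = 0
    · rw [hgj, zero_mul]
    · have hle : j ≤ i := Finset.le_max' _ j (by simp [hgj])
      have hlt : (j : ι) < (i : ι) :=
        lt_of_le_of_ne (Subtype.coe_le_coe.mpr hle) (fun h => hji (Subtype.ext h))
      rw [hwa j j.2 i hlt, mul_zero]
  · intro h; exact absurd (Finset.mem_univ i) h

omit [LinearOrder ι] in
/-- A family `u m` (`m ∈ P`) with `u m m = 1` and `u m m' = 0` for `m' ∈ P`, `m' ≠ m` («reduced with
respect to `P`») is linearly independent: evaluate a vanishing combination at the coordinates in `P`. -/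
theorem linearIndependent_reduced (P : Finset ι) (u : ι → ι → K) (hu1 : ∀ m ∈ P, u m m = 1)
    (hu0 : ∀ m ∈ P, ∀ m' ∈ P, m' ≠ m → u m m' = 0) :
    LinearIndependent K (fun m : P => u m) := by
  classical
  rw [Fintype.linearIndependent_iff]
  intro g hg i
  have hcoord := congr_fun hg (i : ι)
  simp only [Finset.sum_apply, Pi.smul_apply, smul_eq_mul, Pi.zero_apply] at hcoord
  rw [Finset.sum_eq_single i] at hcoord
  · simpa [hu1 i i.2] using hcoord
  · intro j _ hji
    have hne : (i : ι) ≠ (j : ι) := fun h => hji (Subtype.ext h).symm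
    rw [hu0 j j.2 i i.2 hne, mul_zero]
  · intro h; exact absurd (Finset.mem_univ i) h

variable [Fintype ι]

/-- Every non-zero vector has a lead (`ι` finite): a coordinate where it is non-zero above which it
vanishes. -/
theorem exists_lead_of_ne_zero (v : ι → K) (hv : v ≠ 0) :
    ∃ m, v m ≠ 0 ∧ ∀ m', m < m' → v m' = 0 := by
  classical
  have hne : (Finset.univ.filter fun m => v m ≠ 0).Nonempty := by
    by_contra hcon
    rw [Finset.not_nonempty_iff_eq_empty, Finset.filter_eq_empty_iff] at hcon
    apply hv
    funext m
    simpa using hcon (Finset.mem_univ m)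
  refine ⟨(Finset.univ.filter fun m => v m ≠ 0).max' hne, ?_, ?_⟩
  · have := Finset.max'_mem _ hne
    rw [Finset.mem_filter] at this
    exact this.2
  · intro m' hlt
    by_contra hm'
    have hmem : m' ∈ Finset.univ.filter fun m => v m ≠ 0 := by
      rw [Finset.mem_filter]; exact ⟨Finset.mem_univ _, hm'⟩
    exact absurd (Finset.le_max' _ m' hmem) (not_le.mpr hlt)

variable (U : Submodule K (ι → K)) (P : Finset ι)

omit [Fintype ι] in
/-- `P` IS THE PIVOT SET of `U`: `m ∈ P` iff `m` is the lead of some vector of `U`.  (Hypothesis `hP`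
of the theorems below; for `ι` finite such a `P` always exists, e.g. by `Set.toFinset`.) -/
theorem pivot_mem_iff_intro (hP : ∀ m, m ∈ P ↔ ∃ v ∈ U, v m ≠ 0 ∧ ∀ m', m < m' → v m' = 0)
    {v : ι → K} (hv : v ∈ U) {m : ι} (hm : v m ≠ 0) (hma : ∀ m', m < m' → v m' = 0) : m ∈ P :=
  (hP m).mpr ⟨v, hv, hm, hma⟩

/-- A vector of `U` that vanishes at every pivot of `U` is zero (its lead would be a pivot). -/
theorem eq_zero_of_forall_pivot (hP : ∀ m, m ∈ P ↔ ∃ v ∈ U, v m ≠ 0 ∧ ∀ m', m < m' → v m' = 0)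
    {v : ι → K} (hv : v ∈ U) (h : ∀ m ∈ P, v m = 0) : v = 0 := by
  by_contra hne
  obtain ⟨m, hm, hma⟩ := exists_lead_of_ne_zero v hne
  exact hm (h m ((hP m).mpr ⟨v, hv, hm, hma⟩))

/-- UNIQUENESS of the reduced vector at a pivot `m`: two vectors of `U` with coordinate `1` at `m` and
`0` at every other pivot coincide (their difference lies in `U` and vanishes at every pivot). -/
theorem reduced_unique (hP : ∀ m, m ∈ P ↔ ∃ v ∈ U, v m ≠ 0 ∧ ∀ m', m < m' → v m' = 0) {m : ι}
    {u u' : ι → K} (huU : u ∈ U) (hum : u m = 1) (hu0 : ∀ m' ∈ P, m' ≠ m → u m' = 0)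
    (hu'U : u' ∈ U) (hu'm : u' m = 1) (hu'0 : ∀ m' ∈ P, m' ≠ m → u' m' = 0) : u = u' := by
  have hz : u - u' = 0 := by
    refine eq_zero_of_forall_pivot U P hP (U.sub_mem huU hu'U) ?_
    intro m' hm'
    by_cases hmm : m' = m
    · subst hmm; simp [hum, hu'm]
    · simp [hu0 m' hm' hmm, hu'0 m' hm' hmm]
  exact sub_eq_zero.mp hz

/-- The LEAD of the reduced vector at `m` is `m`: it is `1 ≠ 0` at `m` and vanishes above `m` (its
highest non-zero coordinate is a pivot other than `m` otherwise — where it must vanish).  So «pivot =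
highest monomial» holds automatically for reduced vectors. -/
theorem lead_of_reduced (hP : ∀ m, m ∈ P ↔ ∃ v ∈ U, v m ≠ 0 ∧ ∀ m', m < m' → v m' = 0) {m : ι}
    {u : ι → K} (huU : u ∈ U) (hum : u m = 1) (hu0 : ∀ m' ∈ P, m' ≠ m → u m' = 0) :
    u m ≠ 0 ∧ ∀ m', m < m' → u m' = 0 := by
  classical
  refine ⟨by rw [hum]; exact one_ne_zero, ?_⟩
  intro m' hlt
  by_contra hne
  have hS : (Finset.univ.filter fun k => u k ≠ 0).Nonempty := ⟨m', by simp [hne]⟩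
  set k := (Finset.univ.filter fun k => u k ≠ 0).max' hS with hk
  have hkmem : u k ≠ 0 := by
    have := Finset.max'_mem _ hS; rw [Finset.mem_filter] at this; exact this.2
  have hka : ∀ k', k < k' → u k' = 0 := by
    intro k' hk'
    by_contra hk'ne
    have : k' ∈ Finset.univ.filter fun k => u k ≠ 0 := by simp [hk'ne]
    exact absurd (Finset.le_max' _ k' this) (not_le.mpr hk')
  have hkm : m' ≤ k := Finset.le_max' _ m' (by simp [hne])
  have hkne : k ≠ m := ne_of_gt (lt_of_lt_of_le hlt hkm)
  exact hkmem (hu0 k ((hP k).mpr ⟨u, huU, hkmem, hka⟩) hkne)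

/-- EXPANSION in a reduced family: if `u m` is reduced at `m` for every pivot `m ∈ P`, then every
`v ∈ U` equals `∑_{m ∈ P} v m • u m` (the difference lies in `U` and vanishes at every pivot).  In
particular a reduced family spans `U`. -/
theorem eq_sum_smul_reduced (hP : ∀ m, m ∈ P ↔ ∃ v ∈ U, v m ≠ 0 ∧ ∀ m', m < m' → v m' = 0)
    (u : ι → ι → K) (huU : ∀ m ∈ P, u m ∈ U) (hu1 : ∀ m ∈ P, u m m = 1)
    (hu0 : ∀ m ∈ P, ∀ m' ∈ P, m' ≠ m → u m m' = 0) {v : ι → K} (hv : v ∈ U) :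
    v = ∑ m ∈ P, v m • u m := by
  classical
  have hmem : v - ∑ m ∈ P, v m • u m ∈ U :=
    U.sub_mem hv (U.sum_mem fun m hm => U.smul_mem (v m) (huU m hm))
  have hz := eq_zero_of_forall_pivot U P hP hmem (by
    intro m' hm'
    simp only [Pi.sub_apply, Finset.sum_apply, Pi.smul_apply, smul_eq_mul]
    rw [Finset.sum_eq_single m']
    · rw [hu1 m' hm', mul_one, sub_self]
    · intro m hm hne
      rw [hu0 m hm m' hm' (Ne.symm hne), mul_zero]
    · intro h; exact absurd hm' h)
  exact (sub_eq_zero.mp hz)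

/-- EXISTENCE of the reduced vector at every pivot.  The pivot-coordinate map `U → (P → K)` is
injective (`eq_zero_of_forall_pivot`); `U` contains `|P|` linearly independent lead vectors
(`linearIndependent_of_lead`), so `finrank U = |P|` and the map is onto; the preimage of the indicator
of `m` is reduced at `m`. -/
theorem exists_reduced (hP : ∀ m, m ∈ P ↔ ∃ v ∈ U, v m ≠ 0 ∧ ∀ m', m < m' → v m' = 0)
    {m : ι} (hm : m ∈ P) : ∃ u ∈ U, u m = 1 ∧ ∀ m' ∈ P, m' ≠ m → u m' = 0 := by
  classical
  let φ : U →ₗ[K] (P → K) :=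
    { toFun := fun v => fun i => (v : ι → K) i
      map_add' := fun v v' => by funext i; simp
      map_smul' := fun c v => by funext i; simp }
  have hφinj : Function.Injective φ := by
    intro v v' hvv'
    apply Subtype.ext
    have hz : ((v : ι → K) - (v' : ι → K)) = 0 := by
      refine eq_zero_of_forall_pivot U P hP (U.sub_mem v.2 v'.2) ?_
      intro m' hm'
      have := congr_fun hvv' ⟨m', hm'⟩
      simp only [φ, LinearMap.coe_mk, AddHom.coe_mk] at this
      simp [this]
    exact sub_eq_zero.mp hz
  have hlead : ∀ m' ∈ P, ∃ v : ι → K, v ∈ U ∧ (v m' ≠ 0 ∧ ∀ k, m' < k → v k = 0) := fun m' hm' => by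
    obtain ⟨v, hv, hl⟩ := (hP m').mp hm'; exact ⟨v, hv, hl⟩
  choose! w hwU hwlead using hlead
  have hli : LinearIndependent K (fun i : P => (⟨w i, hwU i i.2⟩ : U)) := by
    have hli0 : LinearIndependent K (fun i : P => w i) :=
      linearIndependent_of_lead P w (fun m hm => (hwlead m hm).1) (fun m hm => (hwlead m hm).2)
    exact LinearIndependent.of_comp U.subtype hli0
  have hcard_le : Fintype.card P ≤ Module.finrank K U := hli.fintype_card_le_finrank
  have hle : Module.finrank K U ≤ Module.finrank K (P → K) :=
    LinearMap.finrank_le_finrank_of_injective hφinj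
  have hPK : Module.finrank K (P → K) = Fintype.card P := Module.finrank_fintype_fun_eq_card K
  have hdim : Module.finrank K U = Module.finrank K (P → K) := by omega
  have hsurj : Function.Surjective φ :=
    (LinearMap.injective_iff_surjective_of_finrank_eq_finrank hdim).1 hφinj
  obtain ⟨v, hv⟩ := hsurj (fun i => if (i : ι) = m then 1 else 0)
  refine ⟨(v : ι → K), v.2, ?_, ?_⟩
  · have := congr_fun hv ⟨m, hm⟩
    simpa [φ] using this
  · intro m' hm' hne
    have := congr_fun hv ⟨m', hm'⟩
    simpa [φ, hne] using this

/-- The two halves together: at every pivot there is EXACTLY ONE reduced vector. -/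
theorem existsUnique_reduced (hP : ∀ m, m ∈ P ↔ ∃ v ∈ U, v m ≠ 0 ∧ ∀ m', m < m' → v m' = 0)
    {m : ι} (hm : m ∈ P) : ∃! u : ι → K, u ∈ U ∧ u m = 1 ∧ ∀ m' ∈ P, m' ≠ m → u m' = 0 := by
  obtain ⟨u, huU, hum, hu0⟩ := exists_reduced U P hP hm
  refine ⟨u, ⟨huU, hum, hu0⟩, ?_⟩
  rintro u' ⟨hu'U, hu'm, hu'0⟩
  exact (reduced_unique U P hP huU hum hu0 hu'U hu'm hu'0).symm

end Summit.Ventures.HSemireg.CanonicalReducedBasis
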